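import Literature.Analysis.FluidPDE.Wei2016SwirlCriterionProofs
import HarnessLib

/-!
# Wei 2016, §3: the real-variable skeleton of (3.4)–(3.7) and of the comparison with `F`

Analysis/FluidPDE proof file (theorems only; no definitions, no named facts) on the way to
`Literature.Analysis.FluidPDE.Wei2016_logModulus_regularity`
(`LeiZhang2017AxisymmetricCriteria.lean`), after D. Wei, J. Math. Anal. Appl. 435 (2016) =
arXiv:1508.03318, §3, proof of Thm. 1.1.

Two pieces of the printed proof are pure real-variable bookkeeping once the analytic inequalities
at a fixed time are known; they are isolated here so that the analytic assembly only has to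
supply those inequalities.

* `Wei2016.slice_combination` — **(3.2)+(3.3)+(3.4)+(3.5) ⇒ (3.6) at a fixed time**, with a
  dissipation margin. Inputs (real numbers): the `Ω`-inequality `I_Ω + D_Ω ≤ 2P`
  (`P = ∫ |u_θ/r| |Ω| |J|`), the `J`-inequality `I_J + D_J ≤ ½D_J + ½S` (`S = ∫ u_θ²|∇(u_r/r)|²`),
  Young `2P ≤ λX + λ⁻¹Y`, Lemma 2.3 in the forms `X ≤ M D_Ω^r + C₁F_Ω`, `Y ≤ M D_J^r + C₁F_J`,
  `S ≤ εM H + C₂F_W`, Lemma 2.1 `H ≤ D_Ω^z`, and `D_J^r ≤ D_J`, `D_Ω^r + D_Ω^z ≤ D_Ω`, with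
  Wei's choices `λ = ε^{1/3} = p`, weight `β = ε^{2/3}/2 = p²/2` and the Hardy constant
  `M = θ ε^{-1/3} = θ/p` (`θ = 1` is the paper's `K(ε)`; `θ < 1` keeps the fraction `1 − θ` of the
  dissipation). Output:
  `I_J + β I_Ω + ½(1−θ) D_J + (1−θ) β D_Ω ≤ ½C₂ F_W + β(λ C₁ F_Ω + λ⁻¹ C₁ F_J)`.
* `Wei2016.antitoneOn_F` — `F` is non-increasing on `[0, ∞)`;
* `Wei2016.F_sub_le_F_of_integral_le` — **the comparison with `F` in integrated form**: if
  `A ≥ 0` is continuous on `[0, T]` and `A(t) − A(s) ≤ ∫ₛᵗ g · max{A^{4/3}/κ, ρ}` for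
  `0 ≤ s ≤ t ≤ T` with `g ≥ 0` continuous and `∫₀ᵗ g ≤ G`, then `F(A(0)) − G ≤ F(A(t))` on
  `[0, T]` — apply the differential form `F_sub_le_F_of_deriv_le` to the `C¹` majorant
  `B(t) = A(0) + ∫₀ᵗ g · max{A^{4/3}/κ, ρ} ≥ A(t)` (`B' = g max{A^{4/3}/κ, ρ} ≤ g max{B^{4/3}/κ, ρ}`)
  and use that `F` is non-increasing (no differentiability of `A` is needed: in Tao's class
  `A(t) = ‖J‖² + ½ε^{2/3}‖Ω‖²` is only known to be an absolutely continuous function of time);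
* `Wei2016.le_of_F_sub_le` — "`F(A(0)) > G` ⟹ `sup A < ∞`", quantitatively:
  `A(t) ≤ max{y₀, (3κ/(F(A(0)) − G))³}`.

## References

* D. Wei, arXiv:1508.03318, §3, (3.4)–(3.7) and the comparison with `F` (pp. 7–8). [Wei2016]
* I. Bihari, Acta Math. Acad. Sci. Hungar. 7 (1956) 81–94 (the nonlinear integral inequality).
  [folklore]
-/

noncomputable section

open MeasureTheory Set Function Filter Topology intervalIntegral

namespace Literature.Analysis.FluidPDE

namespace Wei2016

/-! ### (3.6) at a fixed time, as real-variable bookkeeping -/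

/-- **Wei 2016, (3.4)–(3.6) at a fixed time** (real-variable form, with a dissipation margin
`1 − θ`). Notation: `p = ε^{1/3}`, Hardy constant `M = θ/p` (`θ ≤ 1`), Young parameter `λ = p`,
weight `β = p²/2`. Hypotheses: the `Ω`-inequality `IΩ + DΩ ≤ p X + p⁻¹ Y` (energy inequality of
`Ω` followed by Young), the `J`-inequality `IJ + DJ ≤ DJ/2 + S/2`, Lemma 2.3:
`X ≤ (θ/p) DΩr + C₁ FΩ`, `Y ≤ (θ/p) DJr + C₁ FJ`, `S ≤ p³ (θ/p) H + C₂ FW`, Lemma 2.1 `H ≤ DΩz`,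
and `DJr ≤ DJ`, `DΩr + DΩz ≤ DΩ`. Conclusion:
`IJ + (p²/2) IΩ + (1−θ)/2 · DJ + (1−θ)(p²/2) DΩ ≤ C₂/2 · FW + (p²/2)(p C₁ FΩ + p⁻¹ C₁ FJ)`.
[cite: Wei2016, §3 (3.4)–(3.6)] -/
theorem slice_combination {p θ C₁ C₂ IJ IΩ DJ DJr DΩ DΩr DΩz X Y S H FΩ FJ FW : ℝ}
    (hp : 0 < p) (hθ0 : 0 ≤ θ)
    (hΩ : IΩ + DΩ ≤ p * X + p⁻¹ * Y) (hJ : IJ + DJ ≤ DJ / 2 + S / 2)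
    (hX : X ≤ θ / p * DΩr + C₁ * FΩ) (hY : Y ≤ θ / p * DJr + C₁ * FJ)
    (hS : S ≤ p ^ 3 * (θ / p) * H + C₂ * FW) (hH : H ≤ DΩz)
    (hDJr : DJr ≤ DJ) (hDΩ : DΩr + DΩz ≤ DΩ) :
    IJ + p ^ 2 / 2 * IΩ + (1 - θ) / 2 * DJ + (1 - θ) * (p ^ 2 / 2) * DΩ ≤
      C₂ / 2 * FW + p ^ 2 / 2 * (p * C₁ * FΩ + p⁻¹ * C₁ * FJ) := by
  have hp2 : 0 < p ^ 2 / 2 := by positivity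
  -- multiply the `Ω`-chain by `p²/2`
  have h1 : p ^ 2 / 2 * (IΩ + DΩ) ≤ p ^ 2 / 2 * (p * X + p⁻¹ * Y) :=
    mul_le_mul_of_nonneg_left hΩ hp2.le
  have h2 : p ^ 2 / 2 * (p * X) ≤ p ^ 2 / 2 * (p * (θ / p * DΩr + C₁ * FΩ)) :=
    mul_le_mul_of_nonneg_left (mul_le_mul_of_nonneg_left hX hp.le) hp2.le
  have h3 : p ^ 2 / 2 * (p⁻¹ * Y) ≤ p ^ 2 / 2 * (p⁻¹ * (θ / p * DJr + C₁ * FJ)) :=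
    mul_le_mul_of_nonneg_left (mul_le_mul_of_nonneg_left hY (inv_nonneg.2 hp.le)) hp2.le
  -- the `J`-chain
  have h4 : S / 2 ≤ (p ^ 3 * (θ / p) * H + C₂ * FW) / 2 := by linarith
  have h5 : p ^ 3 * (θ / p) * H ≤ p ^ 3 * (θ / p) * DΩz :=
    mul_le_mul_of_nonneg_left hH (by positivity)
  -- algebraic simplifications of the products of powers of `p`
  have e1 : p ^ 2 / 2 * (p * (θ / p * DΩr)) = θ * (p ^ 2 / 2) * DΩr := by
    field_simp
  have e2 : p ^ 2 / 2 * (p⁻¹ * (θ / p * DJr)) = θ / 2 * DJr := by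
    field_simp
  have e3 : p ^ 3 * (θ / p) * DΩz = θ * p ^ 2 * DΩz := by
    field_simp
  -- the dissipation that is consumed
  have h6 : θ * (p ^ 2 / 2) * DΩr + θ * p ^ 2 * DΩz / 2 ≤ θ * (p ^ 2 / 2) * DΩ := by
    have : θ * (p ^ 2 / 2) * (DΩr + DΩz) ≤ θ * (p ^ 2 / 2) * DΩ :=
      mul_le_mul_of_nonneg_left hDΩ (by positivity)
    linarith
  have h7 : θ / 2 * DJr ≤ θ / 2 * DJ := mul_le_mul_of_nonneg_left hDJr (by positivity)
  nlinarith [h1, h2, h3, h4, h5, h6, h7, e1, e2, e3]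

/-! ### The comparison with `F`, integrated form -/

section Comparison

variable {κ ρ : ℝ}

/-- `F` is non-increasing on `[0, ∞)` (`F' = dF ≤ 0` there). [folklore] -/
theorem antitoneOn_F (hκ : 0 < κ) (hρ : 0 < ρ) : AntitoneOn (F κ ρ) (Ici 0) := by
  refine antitoneOn_of_deriv_nonpos (convex_Ici 0) (continuous_F hκ hρ).continuousOn ?_ ?_
  · exact fun y _ => (hasDerivAt_F hκ hρ y).differentiableAt.differentiableWithinAt
  · rw [interior_Ici]
    intro y hy
    rw [(hasDerivAt_F hκ hρ y).deriv]
    exact dF_nonpos hκ hρ (le_of_lt hy)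

/-- **"`F(A(0)) > G` ⟹ `sup A < ∞`"**, quantitatively: if `F(A(0)) − G ≤ F(y)`, `G < F(A(0))` and
`y ≥ 0` then `y ≤ max{y₀, (3κ/(F(A(0)) − G))³}` (for `y ≥ y₀`, `F(y) = 3κ y^{-1/3}`).
[cite: Wei2016, proof of Thm. 1.1 (condition (a)')] -/
theorem le_of_F_sub_le (hκ : 0 < κ) (hρ : 0 < ρ) {A₀ G y : ℝ}
    (hF : F κ ρ A₀ - G ≤ F κ ρ y) (hlt : G < F κ ρ A₀) :
    y ≤ max (yJ κ ρ) ((3 * κ / (F κ ρ A₀ - G)) ^ 3) := by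
  have hc : 0 < F κ ρ A₀ - G := sub_pos.2 hlt
  by_cases hy : yJ κ ρ ≤ y
  · refine le_max_of_le_right ?_
    have hypos : 0 < y := (yJ_pos hκ hρ).trans_le hy
    rw [F_of_le hy, Real.rpow_neg hypos.le] at hF
    have hcube : 0 < y ^ (1 / 3 : ℝ) := Real.rpow_pos_of_pos hypos _
    have h1 : y ^ (1 / 3 : ℝ) ≤ 3 * κ / (F κ ρ A₀ - G) := by
      rw [le_div_iff₀ hc]
      have h2 : (F κ ρ A₀ - G) * y ^ (1 / 3 : ℝ) ≤ 3 * κ * (y ^ (1 / 3 : ℝ))⁻¹ * y ^ (1 / 3 : ℝ) :=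
        mul_le_mul_of_nonneg_right hF hcube.le
      rw [inv_mul_cancel_right₀ hcube.ne'] at h2
      linarith
    calc y = (y ^ (1 / 3 : ℝ)) ^ 3 := by
          rw [← Real.rpow_natCast, ← Real.rpow_mul hypos.le]
          norm_num
      _ ≤ (3 * κ / (F κ ρ A₀ - G)) ^ 3 := by gcongr
  · exact le_max_of_le_left (not_le.1 hy).le

/-- **The comparison with `F` in integrated form** (Wei 2016, §3: "we can use the energy identity
to obtain `F(A(0)) − F(A(t)) ≤ ∫₀ᵗ C M₂ ‖∇u(s)‖² ds ≤ C₁M₂‖u₀‖²`"), for a merely continuous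
`A ≥ 0` on `[0, T]` obeying the *integrated* inequality
`A(t) − A(s) ≤ ∫ₛᵗ g(τ) max{A(τ)^{4/3}/κ, ρ} dτ` (`0 ≤ s ≤ t ≤ T`), with `g ≥ 0` continuous on
`[0, T]` and `∫₀ᵗ g ≤ G`: then `F(A(0)) − G ≤ F(A(t))` for all `t ∈ [0, T]`. Proof (Bihari): the
majorant `B(t) = A(0) + ∫₀ᵗ g max{A^{4/3}/κ, ρ}` is `C¹`, `B ≥ A ≥ 0`, and
`B' = g max{A^{4/3}/κ, ρ} ≤ g max{B^{4/3}/κ, ρ}`; the differential comparison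
`F_sub_le_F_of_deriv_le` gives `F(B(0)) − G ≤ F(B(t))`, and `F(B(t)) ≤ F(A(t))` because `F` is
non-increasing; the endpoint `t = T` follows by continuity. [cite: Wei2016, proof of Thm. 1.1 (comparison with F)] -/
theorem F_sub_le_F_of_integral_le {A g : ℝ → ℝ} {T G : ℝ} (hκ : 0 < κ) (hρ : 0 < ρ) (hT : 0 < T)
    (hAc : ContinuousOn A (Icc 0 T)) (hgc : ContinuousOn g (Icc 0 T))
    (hA0 : ∀ t ∈ Icc 0 T, 0 ≤ A t) (hg0 : ∀ t ∈ Icc 0 T, 0 ≤ g t)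
    (hineq : ∀ s t, 0 ≤ s → s ≤ t → t ≤ T →
      A t - A s ≤ ∫ τ in s..t, g τ * max (A τ ^ (4 / 3 : ℝ) / κ) ρ)
    (hG : ∀ t ∈ Icc 0 T, ∫ s in (0 : ℝ)..t, g s ≤ G) :
    ∀ t ∈ Icc 0 T, F κ ρ (A 0) - G ≤ F κ ρ (A t) := by
  -- the density `ψ = g · max{A^{4/3}/κ, ρ}` is continuous and nonnegative on `[0, T]`
  set ψ : ℝ → ℝ := fun τ => g τ * max (A τ ^ (4 / 3 : ℝ) / κ) ρ with hψ
  have hA43 : ContinuousOn (fun τ => A τ ^ (4 / 3 : ℝ)) (Icc 0 T) :=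
    hAc.rpow_const fun τ _ => Or.inr (by norm_num)
  have hd : ContinuousOn (fun τ => A τ ^ (4 / 3 : ℝ) / κ) (Icc 0 T) := hA43.div_const κ
  have hmax : ContinuousOn (fun τ => max (A τ ^ (4 / 3 : ℝ) / κ) ρ) (Icc 0 T) :=
    continuous_max.comp_continuousOn (hd.prodMk continuousOn_const)
  have hψc : ContinuousOn ψ (Icc 0 T) := hgc.mul hmax
  have hψ0 : ∀ τ ∈ Icc 0 T, 0 ≤ ψ τ := fun τ hτ =>
    mul_nonneg (hg0 τ hτ) (le_max_of_le_right hρ.le)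
  -- the majorant `B`
  set B : ℝ → ℝ := fun t => A 0 + ∫ τ in (0 : ℝ)..t, ψ τ with hB
  have hψi : ∀ t ∈ Icc 0 T, IntervalIntegrable ψ volume 0 t := fun t ht =>
    (hψc.mono (Icc_subset_Icc_right ht.2)).intervalIntegrable_of_Icc ht.1
  have hBc : ContinuousOn B (Icc 0 T) := by
    have h := intervalIntegral.continuousOn_primitive_interval (μ := volume) (a := 0) (b := T)
      (f := ψ) (by rw [uIcc_of_le hT.le]; exact hψc.integrableOn_Icc)
    rw [uIcc_of_le hT.le] at h
    exact continuousOn_const.add h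
  have hBA : ∀ t ∈ Icc 0 T, A t ≤ B t := by
    intro t ht
    have h := hineq 0 t le_rfl ht.1 ht.2
    simp only [hB]
    linarith
  have hB0 : B 0 = A 0 := by simp [hB]
  have hBge : ∀ t ∈ Icc 0 T, 0 ≤ B t := fun t ht => (hA0 t ht).trans (hBA t ht)
  have hBderiv : ∀ t ∈ Ioo 0 T, HasDerivAt B (ψ t) t := by
    intro t ht
    have htI : t ∈ Icc 0 T := ⟨ht.1.le, ht.2.le⟩
    have h2 : HasDerivAt (fun s => ∫ τ in (0 : ℝ)..s, ψ τ) (ψ t) t := by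
      refine intervalIntegral.integral_hasDerivAt_right (hψi t htI) ?_ ?_
      · exact (hψc.mono Ioo_subset_Icc_self).stronglyMeasurableAtFilter isOpen_Ioo t ht
      · exact hψc.continuousAt (Icc_mem_nhds ht.1 ht.2)
    simpa [hB] using h2.const_add (A 0)
  -- `B' ≤ g · max{B^{4/3}/κ, ρ}`
  have hBineq : ∀ t ∈ Ioo 0 T, ψ t ≤ g t * max (B t ^ (4 / 3 : ℝ) / κ) ρ := by
    intro t ht
    have htI : t ∈ Icc 0 T := ⟨ht.1.le, ht.2.le⟩
    refine mul_le_mul_of_nonneg_left (max_le_max ?_ le_rfl) (hg0 t htI)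
    exact div_le_div_of_nonneg_right
      (Real.rpow_le_rpow (hA0 t htI) (hBA t htI) (by norm_num)) hκ.le
  -- the differential comparison for `B` on `[0, T)`
  have hcomp := F_sub_le_F_of_deriv_le (T := T) (G := G) hκ hρ (hBc.mono Ico_subset_Icc_self)
    (hgc.mono Ico_subset_Icc_self) (fun t ht => hBge t (Ico_subset_Icc_self ht)) hBderiv hBineq
    (fun t ht => hG t (Ico_subset_Icc_self ht))
  -- conclusion on `[0, T)`
  have hIco : ∀ t ∈ Ico 0 T, F κ ρ (A 0) - G ≤ F κ ρ (A t) := by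
    intro t ht
    have h1 := hcomp t ht
    rw [hB0] at h1
    have h2 : F κ ρ (B t) ≤ F κ ρ (A t) :=
      antitoneOn_F hκ hρ (hA0 t (Ico_subset_Icc_self ht)) (hBge t (Ico_subset_Icc_self ht))
        (hBA t (Ico_subset_Icc_self ht))
    exact h1.trans h2
  -- the endpoint by continuity
  intro t ht
  rcases lt_or_eq_of_le ht.2 with hlt | heq
  · exact hIco t ⟨ht.1, hlt⟩
  · subst heq
    have hFA : ContinuousWithinAt (fun s => F κ ρ (A s)) (Ico 0 t) t :=
      ((continuous_F hκ hρ).continuousAt.comp_continuousWithinAt (hAc t ht)).mono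
        Ico_subset_Icc_self
    have hmem : t ∈ closure (Ico 0 t) := by
      rw [closure_Ico hT.ne]
      exact ⟨ht.1, le_rfl⟩
    haveI : (𝓝[Ico 0 t] t).NeBot := mem_closure_iff_nhdsWithin_neBot.1 hmem
    exact ge_of_tendsto hFA.tendsto (eventually_nhdsWithin_of_forall fun s hs => hIco s hs)

end Comparison

end Wei2016

end Literature.Analysis.FluidPDE

end
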